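import Literature.NumberTheory.ModularForms.PoincareSeriesWeightTwoCosetSeries
import Literature.NumberTheory.ModularForms.PoincareSeriesWeightTwoHeckeLimit
import Mathlib.Analysis.SpecialFunctions.Integrals.Basic
import HarnessLib

/-!
# The Fourier modes of the weight-2 Hecke–Poincaré series of `Γ₀(N)` at the cusp `0` and the size of
# the coset series (Iwaniec–Kowalski §14.2 at `k = 2` with Hecke's factor; Iwaniec (3.17) for the
# cusp pair `(∞, 0)`)

Topic `Literature/NumberTheory/ModularForms` (namespace `Literature.NumberTheory.ModularForms.PoincareWeightTwo`,
continuing `…CosetSeries.lean` (the coset series `cosetP` of `Γ₀(N)S`, its classes) and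
`…HeckeLimit.lean` / `…ModeIntegral.lean` (the cell integral `I_s(A,B;y)` and its decay)). Definitions
with bodies (`cosetRowMode`, `cosetPhase`) and THEOREMS; no named fact.

For `N ≥ 2`, `m ≥ 1`, `s > 0`, `y > 0`: the `N`-periodic function `x ↦ cosetP N m s (x+iy)` has the
Fourier coefficients

  `(1/N) ∫₀ᴺ cosetP(x+iy) e(−nx/N) dx = (1/N) Σ_{a ≥ 1, (a,N)=1} a^{−2−2s} S(−n, m·w_a; a) I_s(m/a², n/N; y)`,

`w_a = (−N)⁻¹ (mod a)` (unfolding of the classes `(N(d₀ + aℓ), a)`, the shift `t ↦ t − Nd₀/a`, and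
`(γ_v S)τ = α/a − 1/(a(aτ − Nd₀))` with `α d₀ ≡ −N⁻¹`), whence by Weil's bound (tree theorem
`weil_kloosterman_bound_holds`, `gcd(m w_a, a) = gcd(m, a) ≤ m`), the divisor bound and the decay
`‖I_s(A,B;y)‖ ≤ (2π/y)(y/2)^{−2s}e^{−π|B|y}` of the cell integral, the pointwise Fourier series gives
**`‖cosetP N m s τ‖ ≤ (W/N)(2π/y)(y/2)^{−2s} Σ_{n∈ℤ} e^{−π|n|y/N}`** (`norm_cosetP_le`), `y = Im τ`,
uniformly in `s > 0` — the size of `P_m(·,s)` towards the cusp `0` needed by stub T4a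
`stub_heckeDomination` of the I1 skeleton
`Summits/Parity/GeneralizedHardyLittlewood/Cruxes/PeterssonBoundPrinted/Lines/poincare_hecke.lean`.

## References

* [IwaniecKowalski2004] H. Iwaniec, E. Kowalski, *Analytic Number Theory*, AMS Colloq. Publ. 53,
  §14.2 (proof of Lemma 14.2), §3.2.
* [Iwaniec2002] H. Iwaniec, *Spectral Methods of Automorphic Forms*, §2.4–§2.5 ((2.23), (2.25)), §3.4 (3.17).
-/

noncomputable section

open scoped MatrixGroups Real Topology
open CongruenceSubgroup Complex MeasureTheory Filter Set
open UpperHalfPlane hiding I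
open Literature.NumberTheory.LFunctions (kloostermanSum weil_kloosterman_bound_holds)

namespace Literature.NumberTheory.ModularForms.PoincareWeightTwo

variable {N : ℕ}

/-! ## The horocycle -/

/-- The point `x + iy` of `ℍ`. [folklore] -/
private def hq (x : ℝ) {y : ℝ} (hy : 0 < y) : ℍ := ⟨(x : ℂ) + y * I, by simp [hy]⟩

/-- The underlying complex number of `hq x hy`. [folklore] -/
private theorem hq_coe (x : ℝ) {y : ℝ} (hy : 0 < y) : ((hq x hy : ℍ) : ℂ) = (x : ℂ) + y * I := rfl

/-- `ofComplex (x + iy) = hq x hy`. [folklore] -/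
private theorem ofComplex_eq_hq (x : ℝ) {y : ℝ} (hy : 0 < y) :
    UpperHalfPlane.ofComplex ((x : ℂ) + y * I) = hq x hy :=
  UpperHalfPlane.ofComplex_apply_of_im_pos (by simp [hy])

/-- Translation along the horocycle. [folklore] -/
private theorem vadd_hq (ℓ x : ℝ) {y : ℝ} (hy : 0 < y) : ((ℓ +ᵥ hq x hy : ℍ)) = hq (x + ℓ) hy := by
  ext1
  rw [UpperHalfPlane.coe_vadd, hq_coe, hq_coe]
  push_cast; ring

/-- `x + iy` lies in the vertical strip `|Re| ≤ R` when `|x| ≤ R`. [folklore] -/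
private theorem hq_mem_verticalStrip {y : ℝ} (hy : 0 < y) {R x : ℝ} (hx : |x| ≤ R) :
    hq x hy ∈ verticalStrip R y := by
  rw [mem_verticalStrip_iff]
  exact ⟨by simpa [hq, UpperHalfPlane.re] using hx, by simp [hq, UpperHalfPlane.im]⟩

/-- One coset term is continuous along the horocycle. [cite: IwaniecKowalski2004, §14.1 (14.4)] -/
private theorem continuous_cosetTerm_hq (m : ℕ) (s : ℝ) (v : Row N) {y : ℝ} (hy : 0 < y) :
    Continuous fun x : ℝ ↦ cosetTerm N m s v (hq x hy) := by
  have hden : Continuous fun x : ℝ ↦ rowDenom (cosetRow v) (hq x hy) := by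
    unfold rowDenom; simp only [hq_coe]; fun_prop
  have hne : ∀ x : ℝ, rowDenom (cosetRow v) (hq x hy) ≠ 0 := fun x ↦
    rowDenom_ne_zero _ (isCoprime_cosetRow v) _
  unfold cosetTerm
  refine ((Continuous.inv₀ (hden.pow 2) fun x ↦ pow_ne_zero 2 (hne x)).mul ?_).mul ?_
  · exact Complex.continuous_ofReal.comp
      ((continuous_norm.comp hden).rpow_const fun x ↦ Or.inl (norm_ne_zero_iff.mpr (hne x)))
  · refine Complex.continuous_exp.comp (continuous_const.mul ?_)
    set g : SL(2, ℤ) := rowMatrix v.1 v.2.1 * ModularGroup.S with hg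
    have hnum : Continuous fun x : ℝ ↦ ((g 0 0 : ℤ) : ℂ) * ((hq x hy : ℍ) : ℂ) + ((g 0 1 : ℤ) : ℂ) := by
      simp only [hq_coe]; fun_prop
    have hden' : Continuous fun x : ℝ ↦ ((g 1 0 : ℤ) : ℂ) * ((hq x hy : ℍ) : ℂ) + ((g 1 1 : ℤ) : ℂ) := by
      simp only [hq_coe]; fun_prop
    have hne' : ∀ x : ℝ, ((g 1 0 : ℤ) : ℂ) * ((hq x hy : ℍ) : ℂ) + ((g 1 1 : ℤ) : ℂ) ≠ 0 := by
      intro x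
      have := hne x
      rw [hg, (rowMatrix_mul_S_apply_one v).1, (rowMatrix_mul_S_apply_one v).2]
      simpa [rowDenom] using this
    refine (hnum.div hden' hne').congr fun x ↦ ?_
    rw [UpperHalfPlane.coe_specialLinearGroup_apply]
    simp [hg]

/-- **Uniform majorant on the segment `|x| ≤ N`**:
`‖cosetTerm_v(x+iy)‖ ≤ r(N,y)^{−(2+2s)} ‖vS‖^{−(2+2s)}`. [cite: IwaniecKowalski2004, §14.1 (14.4)–(14.5)] -/
private theorem norm_cosetTerm_hq_le (m : ℕ) {s : ℝ} (hs : 0 < s) (v : Row N) {y : ℝ} (hy : 0 < y)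
    {x : ℝ} (hx : |x| ≤ N) :
    ‖cosetTerm N m s v (hq x hy)‖ ≤
      EisensteinSeries.r ⟨⟨N, y⟩, hy⟩ ^ (-(2 + 2 * s)) * ‖cosetRow v‖ ^ (-(2 + 2 * s)) := by
  refine (norm_cosetTerm_le m s v _).trans ?_
  have h := EisensteinSeries.summand_bound_of_mem_verticalStrip (by linarith : (0 : ℝ) ≤ 2 + 2 * s)
    (cosetRow v) hy (hq_mem_verticalStrip hy hx)
  simpa [rowDenom] using h

/-- The majorant is summable over the rows. [cite: IwaniecKowalski2004, §14.1 (14.5)] -/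
private theorem summable_cosetMajorant {s : ℝ} (hs : 0 < s) {y : ℝ} (hy : 0 < y) :
    Summable fun v : Row N ↦
      EisensteinSeries.r ⟨⟨N, y⟩, hy⟩ ^ (-(2 + 2 * s)) * ‖cosetRow v‖ ^ (-(2 + 2 * s)) := by
  have h := (EisensteinSeries.summable_one_div_norm_rpow (by linarith : 2 < 2 + 2 * s)).mul_left
    (EisensteinSeries.r ⟨⟨N, y⟩, hy⟩ ^ (-(2 + 2 * s)))
  exact h.comp_injective cosetRow_injective

/-! ## The mode of one coset row (period `N`) -/

/-- The contribution of the row `v` to the `n`-th Fourier mode of period `N` along `Im τ = y`: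
`∫₀ᴺ cosetTerm_v(x+iy) e(−nx/N) dx`. [cite: Iwaniec2002, §3.4 (3.17)] -/
def cosetRowMode (N : ℕ) (m : ℕ) (s : ℝ) (n : ℤ) (y : ℝ) (v : Row N) : ℂ :=
  ∫ x in (0 : ℝ)..N, cosetTerm N m s v (UpperHalfPlane.ofComplex ((x : ℂ) + y * I)) *
    cexp (-(2 * π * I * n * x / N))

/-- `cosetRowMode` along `hq`. [cite: Iwaniec2002, §3.4 (3.17)] -/
private theorem cosetRowMode_eq (m : ℕ) (s : ℝ) (n : ℤ) {y : ℝ} (hy : 0 < y) (v : Row N) :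
    cosetRowMode N m s n y v =
      ∫ x in (0 : ℝ)..N, cosetTerm N m s v (hq x hy) * cexp (-(2 * π * I * n * x / N)) := by
  unfold cosetRowMode
  refine intervalIntegral.integral_congr fun x _ ↦ ?_
  simp only [ofComplex_eq_hq x hy]

/-- `|e(−nx/N)| = 1`. [folklore] -/
private theorem norm_cexp_char (n : ℤ) (x : ℝ) (N : ℕ) : ‖cexp (-(2 * π * I * n * x / N))‖ = 1 := by
  rw [show (-(2 * π * I * n * x / N) : ℂ) = ((-(2 * π * n * x / N) : ℝ) : ℂ) * I by push_cast; ring,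
    Complex.norm_exp_ofReal_mul_I]

/-- The size of a coset row mode. [cite: Iwaniec2002, §3.4 (3.17)] -/
theorem norm_cosetRowMode_le (m : ℕ) {s : ℝ} (hs : 0 < s) (n : ℤ) {y : ℝ} (hy : 0 < y) (v : Row N) :
    ‖cosetRowMode N m s n y v‖ ≤
      (N : ℝ) * (EisensteinSeries.r ⟨⟨N, y⟩, hy⟩ ^ (-(2 + 2 * s)) * ‖cosetRow v‖ ^ (-(2 + 2 * s))) := by
  rw [cosetRowMode_eq m s n hy]
  have h := intervalIntegral.norm_integral_le_of_norm_le_const (a := (0 : ℝ)) (b := N)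
    (C := EisensteinSeries.r ⟨⟨N, y⟩, hy⟩ ^ (-(2 + 2 * s)) * ‖cosetRow v‖ ^ (-(2 + 2 * s)))
    (f := fun x : ℝ ↦ cosetTerm N m s v (hq x hy) * cexp (-(2 * π * I * n * x / N))) ?_
  · calc ‖∫ x in (0 : ℝ)..N, cosetTerm N m s v (hq x hy) * cexp (-(2 * π * I * n * x / N))‖
          ≤ EisensteinSeries.r ⟨⟨N, y⟩, hy⟩ ^ (-(2 + 2 * s)) * ‖cosetRow v‖ ^ (-(2 + 2 * s)) *
            |(N : ℝ) - 0| := h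
      _ = (N : ℝ) * (EisensteinSeries.r ⟨⟨N, y⟩, hy⟩ ^ (-(2 + 2 * s)) * ‖cosetRow v‖ ^ (-(2 + 2 * s))) := by
          rw [sub_zero, abs_of_nonneg (Nat.cast_nonneg N)]; ring
  · intro x hx
    rw [Set.uIoc_of_le (Nat.cast_nonneg N)] at hx
    rw [norm_mul, norm_cexp_char, mul_one]
    exact norm_cosetTerm_hq_le m hs v hy (abs_le.mpr ⟨by linarith [hx.1], hx.2⟩)

/-- The coset row modes are absolutely summable. [cite: Iwaniec2002, §3.4 (3.17)] -/
theorem summable_norm_cosetRowMode (m : ℕ) {s : ℝ} (hs : 0 < s) (n : ℤ) {y : ℝ} (hy : 0 < y) :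
    Summable fun v : Row N ↦ ‖cosetRowMode N m s n y v‖ :=
  ((summable_cosetMajorant hs hy).mul_left (N : ℝ)).of_nonneg_of_le (fun _ ↦ norm_nonneg _)
    (norm_cosetRowMode_le m hs n hy)

/-- The coset row mode is even in the row. [cite: Iwaniec2002, §3.4 (3.17)] -/
theorem cosetRowMode_negRow (m : ℕ) (s : ℝ) (n : ℤ) (y : ℝ) (v : Row N) :
    cosetRowMode N m s n y (negRow v) = cosetRowMode N m s n y v := by
  unfold cosetRowMode
  simp_rw [cosetTerm_negRow]

/-- **Termwise integration**: `∫₀ᴺ cosetP(x+iy,s) e(−nx/N) dx = Σ_v ½ · cosetRowMode v`.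
[cite: Iwaniec2002, §3.4 (3.17)] -/
theorem hasSum_cosetRowMode (m : ℕ) {s : ℝ} (hs : 0 < s) (n : ℤ) {y : ℝ} (hy : 0 < y) :
    HasSum (fun v : Row N ↦ (1 / 2 : ℂ) * cosetRowMode N m s n y v)
      (∫ x in (0 : ℝ)..N, cosetP N m s (UpperHalfPlane.ofComplex ((x : ℂ) + y * I)) *
        cexp (-(2 * π * I * n * x / N))) := by
  have hrw : ∫ x in (0 : ℝ)..N, cosetP N m s (UpperHalfPlane.ofComplex ((x : ℂ) + y * I)) *
      cexp (-(2 * π * I * n * x / N)) =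
      ∫ x in (0 : ℝ)..N, cosetP N m s (hq x hy) * cexp (-(2 * π * I * n * x / N)) :=
    intervalIntegral.integral_congr fun x _ ↦ by simp only [ofComplex_eq_hq x hy]
  rw [hrw]
  simp_rw [cosetRowMode_eq m s n hy, ← intervalIntegral.integral_const_mul]
  set C : ℝ := EisensteinSeries.r ⟨⟨N, y⟩, hy⟩ ^ (-(2 + 2 * s)) with hC
  refine intervalIntegral.hasSum_integral_of_dominated_convergence
    (bound := fun (v : Row N) (_ : ℝ) ↦ 1 / 2 * (C * ‖cosetRow v‖ ^ (-(2 + 2 * s)))) ?_ ?_ ?_ ?_ ?_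
  · intro v
    exact (continuous_const.mul ((continuous_cosetTerm_hq m s v hy).mul
      (by fun_prop : Continuous fun x : ℝ ↦ cexp (-(2 * π * I * n * x / N))))).aestronglyMeasurable
  · intro v
    refine Eventually.of_forall fun x hx ↦ ?_
    rw [Set.uIoc_of_le (Nat.cast_nonneg N)] at hx
    rw [norm_mul, norm_mul, norm_cexp_char, mul_one, show ‖(1 / 2 : ℂ)‖ = 1 / 2 by norm_num]
    exact mul_le_mul_of_nonneg_left
      (norm_cosetTerm_hq_le m hs v hy (abs_le.mpr ⟨by linarith [hx.1], hx.2⟩)) (by norm_num)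
  · exact Eventually.of_forall fun x _ ↦ (summable_cosetMajorant hs hy).mul_left _
  · exact intervalIntegrable_const
  · refine Eventually.of_forall fun x _ ↦ ?_
    have h := (hasSum_cosetP (N := N) m hs (hq x hy)).mul_right (cexp (-(2 * π * I * n * x / N)))
    exact h.congr_fun fun v ↦ by ring

/-! ## One coset row with `d > 0`: the shift `t ↦ t − c/d` -/

/-- The integrand of the cell integral `I_s(A, B; y)` at the real point `w`. [cite: IwaniecKowalski2004, §14.2 (proof of Lemma 14.2)] -/
private def modeIntegrand' (s A B y w : ℝ) : ℂ :=
  (((w : ℂ) + y * I) ^ 2)⁻¹ * ((‖(w : ℂ) + y * I‖ ^ (-(2 * s)) : ℝ) : ℂ) *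
    cexp (2 * π * I * (-(A : ℂ) / ((w : ℂ) + y * I) - B * w))

/-- `modeIntegral s A B y = ∫ modeIntegrand'`. [cite: IwaniecKowalski2004, §14.2 (proof of Lemma 14.2)] -/
private theorem modeIntegral_eq' (s A B y : ℝ) :
    modeIntegral s A B y = ∫ w : ℝ, modeIntegrand' s A B y w := rfl

/-- The cell integrand is integrable for `s ≥ 0`, `A ≥ 0`. [cite: IwaniecKowalski2004, §14.2 (proof of Lemma 14.2)] -/
private theorem integrable_modeIntegrand' {s A y : ℝ} (hs : 0 ≤ s) (hA : 0 ≤ A) (hy : 0 < y) (B : ℝ) :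
    Integrable (modeIntegrand' s A B y) := by
  refine Integrable.mono' ((Literature.Analysis.SpecialFunctions.integrable_inv_sq_add_sq_of_ne_zero'
    hy.ne').const_mul (y ^ (-(2 * s)))) (continuous_modeIntegrand s A B hy).aestronglyMeasurable
    (Eventually.of_forall fun w ↦ ?_)
  have hWim : 0 < ((w : ℂ) + y * I).im := by simp [hy]
  have hnorm : ‖(w : ℂ) + y * I‖ ^ 2 = w ^ 2 + y ^ 2 := by
    rw [Complex.sq_norm, Complex.normSq_add_mul_I]
  have hyle : y ≤ ‖(w : ℂ) + y * I‖ := by simpa using Complex.im_le_norm ((w : ℂ) + y * I)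
  have h1 : ‖(((w : ℂ) + y * I) ^ 2)⁻¹‖ = (w ^ 2 + y ^ 2)⁻¹ := by rw [norm_inv, norm_pow, hnorm]
  have h2 : ‖(((‖(w : ℂ) + y * I‖ ^ (-(2 * s)) : ℝ) : ℂ))‖ ≤ y ^ (-(2 * s)) := by
    rw [Complex.norm_real, Real.norm_of_nonneg (Real.rpow_nonneg (norm_nonneg _) _)]
    exact Real.rpow_le_rpow_of_nonpos hy hyle (by linarith)
  have h3 : ‖cexp (2 * π * I * (-(A : ℂ) / ((w : ℂ) + y * I) - B * w))‖ ≤ 1 := by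
    have hsplit : cexp (2 * π * I * (-(A : ℂ) / ((w : ℂ) + y * I) - B * w)) =
        cexp (2 * π * I * (-(A : ℂ) / ((w : ℂ) + y * I))) * cexp (((-(2 * π * B * w)) : ℝ) * I) := by
      rw [← Complex.exp_add]; congr 1; push_cast; ring
    rw [hsplit, norm_mul, Complex.norm_exp_ofReal_mul_I, mul_one, Complex.norm_exp, Real.exp_le_one_iff]
    have him : (-(A : ℂ) / ((w : ℂ) + y * I)).im =
        A * ((w : ℂ) + y * I).im / Complex.normSq ((w : ℂ) + y * I) := by
      rw [Complex.div_im]; simp; ring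
    have hre : (2 * π * I * (-(A : ℂ) / ((w : ℂ) + y * I))).re =
        -(2 * π) * (-(A : ℂ) / ((w : ℂ) + y * I)).im := by
      simp [Complex.mul_re]
    rw [hre, him]
    have hn : 0 < Complex.normSq ((w : ℂ) + y * I) := Complex.normSq_pos.mpr (by
      intro h; rw [h] at hWim; simp at hWim)
    have : 0 ≤ A * ((w : ℂ) + y * I).im / Complex.normSq ((w : ℂ) + y * I) := by positivity
    nlinarith [Real.pi_pos]
  unfold modeIntegrand'
  rw [norm_mul, norm_mul, h1]
  calc (w ^ 2 + y ^ 2)⁻¹ * ‖(((‖(w : ℂ) + y * I‖ ^ (-(2 * s)) : ℝ) : ℂ))‖ *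
        ‖cexp (2 * π * I * (-(A : ℂ) / ((w : ℂ) + y * I) - B * w))‖
      ≤ (w ^ 2 + y ^ 2)⁻¹ * y ^ (-(2 * s)) * 1 := by gcongr
    _ = y ^ (-(2 * s)) * (w ^ 2 + y ^ 2)⁻¹ := by ring

/-- The phase factor of a coset row `v = (c, d)` with `d > 0`:
`(d²)⁻¹ d^{−2s} e((m α − n c/N)/d)`, `α = (γ_v S)₀₀`. [cite: Iwaniec2002, §3.4 (3.17)] -/
def cosetPhase (N : ℕ) (m : ℕ) (s : ℝ) (n : ℤ) (v : Row N) : ℂ :=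
  (((v.1 1 : ℤ) : ℂ) ^ 2)⁻¹ * ((((v.1 1 : ℤ) : ℝ) ^ (-(2 * s)) : ℝ) : ℂ) *
    cexp (2 * π * I * (((m : ℤ) * (rowMatrix v.1 v.2.1 * ModularGroup.S) 0 0 - n * (v.1 0 / N) : ℤ) : ℂ) /
      ((v.1 1 : ℤ) : ℂ))

/-- **The shift `t ↦ t − c/d` on one coset row with `d > 0`**: with `W = (t − c/d) + iy`,
`dW = d(t+iy) − c`, `(γ_vS)(t+iy) = α/d − 1/(d²W)` and `c = N(c/N)`, the coset term times the character
`e(−nt/N)` is `cosetPhase v · [W⁻² |W|^{−2s} e(−(m/d²)/W − (n/N)(t − c/d))]`.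
[cite: Iwaniec2002, §3.4 (3.17)] -/
theorem cosetTerm_mul_cexp [NeZero N] (m : ℕ) (s : ℝ) (n : ℤ) {y : ℝ} (hy : 0 < y) (v : Row N)
    (hd : 0 < v.1 1) (t : ℝ) :
    cosetTerm N m s v (UpperHalfPlane.ofComplex ((t : ℂ) + y * I)) * cexp (-(2 * π * I * n * t / N)) =
      cosetPhase N m s n v *
        modeIntegrand' s ((m : ℝ) / ((v.1 1 : ℤ) : ℝ) ^ 2) ((n : ℝ) / N) y
          (t - ((v.1 0 : ℤ) : ℝ) / ((v.1 1 : ℤ) : ℝ)) := by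
  rw [ofComplex_eq_hq t hy]
  obtain ⟨c₁, hc₁⟩ := v.2.2
  have hN : (0 : ℝ) < N := by exact_mod_cast Nat.pos_of_ne_zero (NeZero.ne N)
  have hNC : (N : ℂ) ≠ 0 := by exact_mod_cast hN.ne'
  have hd0 : v.1 1 ≠ 0 := hd.ne'
  have hdR : (0 : ℝ) < ((v.1 1 : ℤ) : ℝ) := by exact_mod_cast hd
  have hdC : ((v.1 1 : ℤ) : ℂ) ≠ 0 := by exact_mod_cast hd0
  have hdiv : v.1 0 / (N : ℤ) = c₁ := by
    rw [hc₁]; exact Int.mul_ediv_cancel_left _ (by exact_mod_cast NeZero.ne N)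
  have hcC : ((v.1 0 : ℤ) : ℂ) = (N : ℂ) * (c₁ : ℂ) := by rw [hc₁]; push_cast; ring
  -- `W = (t − c/d) + iy`, `dW = d(t+iy) − c = j(τ)`
  have hJ : rowDenom (cosetRow v) (hq t hy) =
      ((v.1 1 : ℤ) : ℂ) * ((((t - ((v.1 0 : ℤ) : ℝ) / ((v.1 1 : ℤ) : ℝ) : ℝ)) : ℂ) + y * I) := by
    rw [rowDenom, hq_coe, cosetRow_zero, cosetRow_one]
    push_cast
    field_simp
    ring
  have hWne : ((((t - ((v.1 0 : ℤ) : ℝ) / ((v.1 1 : ℤ) : ℝ) : ℝ)) : ℂ) + y * I) ≠ 0 := by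
    intro h0; have := congrArg Complex.im h0; simp [hy.ne'] at this
  -- the Möbius action of `g = γ_v S`, bottom row `(d, −c)`
  have hg10 : (rowMatrix v.1 v.2.1 * ModularGroup.S) 1 0 = v.1 1 := by
    rw [(rowMatrix_mul_S_apply_one v).1, cosetRow_zero]
  have hg11 : (rowMatrix v.1 v.2.1 * ModularGroup.S) 1 1 = -(v.1 0) := by
    rw [(rowMatrix_mul_S_apply_one v).2, cosetRow_one]
  have hgden : rowDenom (((rowMatrix v.1 v.2.1 * ModularGroup.S : SL(2, ℤ)) : Matrix (Fin 2) (Fin 2) ℤ) 1)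
      (hq t hy) = rowDenom (cosetRow v) (hq t hy) := by
    simp only [rowDenom]
    rw [show ((((rowMatrix v.1 v.2.1 * ModularGroup.S : SL(2, ℤ)) : Matrix (Fin 2) (Fin 2) ℤ) 1 0)) =
        (rowMatrix v.1 v.2.1 * ModularGroup.S) 1 0 from rfl, hg10,
      show ((((rowMatrix v.1 v.2.1 * ModularGroup.S : SL(2, ℤ)) : Matrix (Fin 2) (Fin 2) ℤ) 1 1)) =
        (rowMatrix v.1 v.2.1 * ModularGroup.S) 1 1 from rfl, hg11, cosetRow_zero, cosetRow_one]
  have hγ : (((rowMatrix v.1 v.2.1 * ModularGroup.S) • hq t hy : ℍ) : ℂ) =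
      (((rowMatrix v.1 v.2.1 * ModularGroup.S) 0 0 : ℤ) : ℂ) / ((v.1 1 : ℤ) : ℂ) -
        1 / (((v.1 1 : ℤ) : ℂ) * rowDenom (cosetRow v) (hq t hy)) := by
    rw [coe_sl_smul_eq _ (by rw [hg10]; exact hd0), hgden, hg10]
  unfold cosetTerm cosetPhase modeIntegrand'
  rw [hγ, hJ, hdiv]
  set W : ℂ := (((t - ((v.1 0 : ℤ) : ℝ) / ((v.1 1 : ℤ) : ℝ) : ℝ)) : ℂ) + y * I with hW
  have hnormdW : ‖((v.1 1 : ℤ) : ℂ) * W‖ = ((v.1 1 : ℤ) : ℝ) * ‖W‖ := by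
    rw [norm_mul, Complex.norm_intCast, abs_of_pos (by exact_mod_cast hd : (0 : ℝ) < (v.1 1 : ℤ))]
  have hrpow : (((v.1 1 : ℤ) : ℝ) * ‖W‖) ^ (-(2 * s)) = ((v.1 1 : ℤ) : ℝ) ^ (-(2 * s)) * ‖W‖ ^ (-(2 * s)) :=
    Real.mul_rpow hdR.le (norm_nonneg _)
  rw [hnormdW, hrpow]
  rw [show ∀ A B C D : ℂ, A * B * cexp C * cexp D = A * B * (cexp C * cexp D) from fun _ _ _ _ ↦ by ring,
    ← Complex.exp_add]
  rw [show ∀ A B C D E F : ℂ, A * B * cexp C * (D * E * cexp F) = (A * B * D * E) * (cexp C * cexp F)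
      from fun _ _ _ _ _ _ ↦ by ring, ← Complex.exp_add]
  congr 1
  · push_cast; field_simp
  · congr 1
    rw [hW]
    push_cast
    rw [hcC]
    field_simp
    ring

/-- **The integral over `ℝ` of one coset row with `d > 0`**, integrable integrand:
`∫_ℝ cosetTerm_v(t+iy) e(−nt/N) dt = cosetPhase v · I_s(m/d², n/N; y)`. [cite: Iwaniec2002, §3.4 (3.17)] -/
theorem integral_cosetTerm_mul_cexp [NeZero N] (m : ℕ) {s : ℝ} (hs : 0 ≤ s) (n : ℤ) {y : ℝ} (hy : 0 < y)
    (v : Row N) (hd : 0 < v.1 1) :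
    Integrable (fun t : ℝ ↦ cosetTerm N m s v (UpperHalfPlane.ofComplex ((t : ℂ) + y * I)) *
      cexp (-(2 * π * I * n * t / N))) ∧
    ∫ t : ℝ, cosetTerm N m s v (UpperHalfPlane.ofComplex ((t : ℂ) + y * I)) *
        cexp (-(2 * π * I * n * t / N)) =
      cosetPhase N m s n v * modeIntegral s ((m : ℝ) / ((v.1 1 : ℤ) : ℝ) ^ 2) ((n : ℝ) / N) y := by
  have hA : 0 ≤ (m : ℝ) / ((v.1 1 : ℤ) : ℝ) ^ 2 := by positivity
  have hG := integrable_modeIntegrand' hs hA hy ((n : ℝ) / N)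
  set δ : ℝ := ((v.1 0 : ℤ) : ℝ) / ((v.1 1 : ℤ) : ℝ) with hδ
  have hpt : (fun t : ℝ ↦ cosetTerm N m s v (UpperHalfPlane.ofComplex ((t : ℂ) + y * I)) *
      cexp (-(2 * π * I * n * t / N))) =
      fun t : ℝ ↦ cosetPhase N m s n v *
        modeIntegrand' s ((m : ℝ) / ((v.1 1 : ℤ) : ℝ) ^ 2) ((n : ℝ) / N) y (t - δ) :=
    funext fun t ↦ cosetTerm_mul_cexp m s n hy v hd t
  rw [hpt]
  refine ⟨(hG.comp_sub_right δ).const_mul _, ?_⟩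
  rw [integral_const_mul, modeIntegral_eq']
  congr 1
  exact integral_sub_right_eq_self (μ := volume)
    (fun w ↦ modeIntegrand' s ((m : ℝ) / ((v.1 1 : ℤ) : ℝ) ^ 2) ((n : ℝ) / N) y w) δ

/-! ## Unfolding the classes with step `N` -/

/-- `Σ_{ℓ ∈ ℤ} ∫₀ᵀ F(x + Tℓ) dx = ∫_ℝ F` for an integrable `F` and `T > 0`. [folklore] -/
private theorem hasSum_intervalIntegral_comp_add_mul_int {F : ℝ → ℂ} (hF : Integrable F) {T : ℝ}
    (hT : 0 < T) : HasSum (fun ℓ : ℤ ↦ ∫ x in (0 : ℝ)..T, F (x + T * ℓ)) (∫ t : ℝ, F t) := by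
  -- reduce to step `1` for `G(u) = T • F(Tu)`
  set G : ℝ → ℂ := fun u ↦ F (T * u) with hGdef
  have hGi : Integrable G := hF.comp_mul_left' hT.ne'
  have hU : (⋃ k : ℤ, Ioc ((0 : ℝ) + k) (0 + k + 1)) = univ := iUnion_Ioc_add_intCast (0 : ℝ)
  have hdisj : Pairwise (Function.onFun Disjoint fun k : ℤ ↦ Ioc ((0 : ℝ) + k) (0 + k + 1)) :=
    pairwise_disjoint_Ioc_add_intCast (0 : ℝ)
  have h := hasSum_integral_iUnion (fun k : ℤ ↦ measurableSet_Ioc) hdisj (by rw [hU]; exact hGi.integrableOn)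
  rw [hU, Measure.restrict_univ] at h
  -- `∫ G = T⁻¹ ∫ F`
  have hGF : ∫ u : ℝ, G u = T⁻¹ • ∫ t : ℝ, F t := by
    simp only [hGdef]
    rw [Measure.integral_comp_mul_left, abs_of_pos (inv_pos.mpr hT)]
  rw [hGF] at h
  have h' := h.const_smul T
  rw [smul_smul, mul_inv_cancel₀ hT.ne', one_smul] at h'
  refine h'.congr_fun fun k ↦ ?_
  simp only [zero_add, hGdef]
  rw [show (∫ u in Ioc (k : ℝ) (k + 1), F (T * u)) = ∫ u in (k : ℝ)..(k + 1), F (T * u) from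
    (intervalIntegral.integral_of_le (by linarith : (k : ℝ) ≤ k + 1)).symm]
  have e1 : T • ∫ u in (k : ℝ)..(k + 1), F (T * u) = ∫ x in T * k..T * (k + 1), F x :=
    intervalIntegral.smul_integral_comp_mul_left F T
  have e2 : ∫ x in (0 : ℝ)..T, F (x + T * k) = ∫ x in 0 + T * k..T + T * k, F x :=
    intervalIntegral.integral_comp_add_right F (T * k)
  rw [e1, e2]
  congr 1 <;> ring

/-- **Unfolding one class**: for `a = r+1` coprime to `N` and a unit `u` mod `a`,
`Σ_{ℓ ∈ ℤ} cosetRowMode (N(d₀ + aℓ), a) = cosetPhase (Nd₀, a) · I_s(m/a², n/N; y)`.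
[cite: Iwaniec2002, §3.4 (3.17)] -/
theorem hasSum_cosetRowMode_class [NeZero N] (m : ℕ) {s : ℝ} (hs : 0 ≤ s) (n : ℤ) {y : ℝ} (hy : 0 < y)
    (a : {r : ℕ // Nat.Coprime (r + 1) N}) (u : (ZMod (a.1 + 1))ˣ) :
    HasSum (fun ℓ : ℤ ↦ cosetRowMode N m s n y (cosetClassRow N a u ℓ))
      (cosetPhase N m s n (cosetClassRow N a u 0) *
        modeIntegral s ((m : ℝ) / (((cosetClassRow N a u 0).1 1 : ℤ) : ℝ) ^ 2) ((n : ℝ) / N) y) := by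
  have hN : (0 : ℝ) < N := by exact_mod_cast Nat.pos_of_ne_zero (NeZero.ne N)
  obtain ⟨hint, hval⟩ := integral_cosetTerm_mul_cexp m hs n hy (cosetClassRow N a u 0)
    (cosetClassRow_apply_one_pos a u 0)
  rw [← hval]
  have h := hasSum_intervalIntegral_comp_add_mul_int hint hN
  -- reindex `ℓ ↦ −ℓ`
  have h2 := (Equiv.neg ℤ).hasSum_iff.mpr h
  refine h2.congr_fun fun ℓ ↦ ?_
  simp only [Function.comp, Equiv.neg_apply, Int.cast_neg]
  rw [cosetRowMode_eq m s n hy]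
  refine intervalIntegral.integral_congr fun x _ ↦ ?_
  rw [ofComplex_eq_hq _ hy, cosetTerm_cosetClassRow, vadd_hq]
  congr 1
  · congr 2; ring
  · have hN0 : (N : ℂ) ≠ 0 := by exact_mod_cast hN.ne'
    rw [show (-(2 * π * I * n * ((x + N * -(ℓ : ℝ) : ℝ) : ℂ) / N) : ℂ) =
      -(2 * π * I * n * x / N) + ((n * ℓ : ℤ) : ℂ) * (2 * π * I) by push_cast; field_simp; ring,
      Complex.exp_add, Complex.exp_int_mul_two_pi_mul_I, mul_one]

/-! ## The Kloosterman sum of a class -/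

/-- **`α · (−N d₀) ≡ 1 (mod a)`** for the class row `(Nd₀, a)`, `α = (γ_v S)₀₀` (the determinant of
`γ_v S = (α β; a −Nd₀)` read mod `a`). [cite: Iwaniec2002, §2.4] -/
theorem cosetAlpha_mul_eq_one [NeZero N] (a : {r : ℕ // Nat.Coprime (r + 1) N}) (u : (ZMod (a.1 + 1))ˣ) :
    (((rowMatrix (cosetClassRow N a u 0).1 (cosetClassRow N a u 0).2.1 * ModularGroup.S) 0 0 : ℤ) :
        ZMod (a.1 + 1)) * (-(((N : ℤ) : ZMod (a.1 + 1))) * (u : ZMod (a.1 + 1))) = 1 := by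
  have hdet := (rowMatrix (cosetClassRow N a u 0).1 (cosetClassRow N a u 0).2.1 * ModularGroup.S).det_coe
  rw [Matrix.det_fin_two] at hdet
  have h10 : (rowMatrix (cosetClassRow N a u 0).1 (cosetClassRow N a u 0).2.1 * ModularGroup.S) 1 0 =
      ((a.1 + 1 : ℕ) : ℤ) := by
    rw [(rowMatrix_mul_S_apply_one _).1, cosetRow_zero, cosetClassRow_apply_one]
  have h11 : (rowMatrix (cosetClassRow N a u 0).1 (cosetClassRow N a u 0).2.1 * ModularGroup.S) 1 1 =
      -((N : ℤ) * ((u : ZMod (a.1 + 1)).val : ℤ)) := by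
    rw [(rowMatrix_mul_S_apply_one _).2, cosetRow_one, cosetClassRow_apply_zero, mul_zero, add_zero]
  rw [h10, h11] at hdet
  have h := congrArg (fun z : ℤ ↦ (z : ZMod (a.1 + 1))) hdet
  simp only [Int.cast_sub, Int.cast_mul, Int.cast_one, Int.cast_neg, Int.cast_natCast, ZMod.natCast_self,
    mul_zero, sub_zero, ZMod.natCast_zmod_val] at h
  rw [← h]
  push_cast
  ring

/-- The integer `m · w`, `w` the least residue of `(−N)⁻¹ (mod A)`: the second argument of the
Kloosterman sum of the classes mod `A`. [cite: Iwaniec2002, §2.5 (2.23)] -/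
def cosetKloostB (N m A : ℕ) : ℤ := (m : ℤ) * ((ZMod.val ((-((N : ℤ) : ZMod A))⁻¹) : ℕ) : ℤ)

/-- `cosetKloostB` in `ℤ/Aℤ` is `m · (−N)⁻¹`. [cite: Iwaniec2002, §2.5 (2.23)] -/
theorem cosetKloostB_cast (N m A : ℕ) [NeZero A] :
    ((cosetKloostB N m A : ℤ) : ZMod A) = (m : ZMod A) * (-((N : ℤ) : ZMod A))⁻¹ := by
  unfold cosetKloostB
  push_cast
  rw [ZMod.natCast_zmod_val]

/-- **The phases of the classes mod `a` add up to a Kloosterman sum**: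
`Σ_{u ∈ (ℤ/aℤ)ˣ} cosetPhase (Nd₀(u), a) = (a²)⁻¹ a^{−2s} S(−n, m w; a)` with `w = (−N)⁻¹ (mod a)`.
[cite: Iwaniec2002, §2.5 (2.23), §3.4 (3.17)] -/
theorem sum_cosetPhase_eq [NeZero N] (m : ℕ) (s : ℝ) (n : ℤ) (a : {r : ℕ // Nat.Coprime (r + 1) N}) :
    ∑ u : (ZMod (a.1 + 1))ˣ, cosetPhase N m s n (cosetClassRow N a u 0) =
      ((((a.1 + 1 : ℕ) : ℂ)) ^ 2)⁻¹ * (((((a.1 + 1 : ℕ) : ℝ)) ^ (-(2 * s)) : ℝ) : ℂ) *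
        kloostermanSum (a.1 + 1) ((-n : ℤ) : ZMod (a.1 + 1))
          ((cosetKloostB N m (a.1 + 1) : ℤ) : ZMod (a.1 + 1)) := by
  classical
  have hterm : ∀ u : (ZMod (a.1 + 1))ˣ, cosetPhase N m s n (cosetClassRow N a u 0) =
      ((((a.1 + 1 : ℕ) : ℂ)) ^ 2)⁻¹ * (((((a.1 + 1 : ℕ) : ℝ)) ^ (-(2 * s)) : ℝ) : ℂ) *
        ZMod.stdAddChar (((-n : ℤ) : ZMod (a.1 + 1)) * (u : ZMod (a.1 + 1)) +
          ((cosetKloostB N m (a.1 + 1) : ℤ) : ZMod (a.1 + 1)) * (u : ZMod (a.1 + 1))⁻¹) := by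
    intro u
    -- `α u = w := (−N)⁻¹`
    have hαu : (((rowMatrix (cosetClassRow N a u 0).1 (cosetClassRow N a u 0).2.1 * ModularGroup.S) 0 0 : ℤ) :
        ZMod (a.1 + 1)) * (u : ZMod (a.1 + 1)) = (-((N : ℤ) : ZMod (a.1 + 1)))⁻¹ := by
      refine (ZMod.inv_eq_of_mul_eq_one (a.1 + 1) _ _ ?_).symm
      linear_combination cosetAlpha_mul_eq_one a u
    have hdiv : (cosetClassRow N a u 0).1 0 / (N : ℤ) = ((u : ZMod (a.1 + 1)).val : ℤ) := by
      rw [cosetClassRow_apply_zero, mul_zero, add_zero]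
      exact Int.mul_ediv_cancel_left _ (by exact_mod_cast NeZero.ne N)
    have huu : (u : ZMod (a.1 + 1)) * (u : ZMod (a.1 + 1))⁻¹ = 1 := ZMod.mul_inv_of_unit _ u.isUnit
    have hcast : ((((m : ℤ) * ((rowMatrix (cosetClassRow N a u 0).1 (cosetClassRow N a u 0).2.1 *
        ModularGroup.S) 0 0) - n * ((cosetClassRow N a u 0).1 0 / (N : ℤ))) : ℤ) : ZMod (a.1 + 1)) =
        ((-n : ℤ) : ZMod (a.1 + 1)) * (u : ZMod (a.1 + 1)) +
          ((cosetKloostB N m (a.1 + 1) : ℤ) : ZMod (a.1 + 1)) * (u : ZMod (a.1 + 1))⁻¹ := by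
      rw [hdiv, cosetKloostB_cast, ← hαu]
      push_cast
      rw [ZMod.natCast_zmod_val]
      linear_combination (-((m : ZMod (a.1 + 1)) *
        (((rowMatrix (cosetClassRow N a u 0).1 (cosetClassRow N a u 0).2.1 * ModularGroup.S) 0 0 : ℤ) :
          ZMod (a.1 + 1)))) * huu
    unfold cosetPhase
    rw [cosetClassRow_apply_one, show ((((a.1 + 1 : ℕ) : ℤ) : ℂ)) = ((a.1 + 1 : ℕ) : ℂ) by push_cast; ring,
      show ((((a.1 + 1 : ℕ) : ℤ) : ℝ)) = ((a.1 + 1 : ℕ) : ℝ) by push_cast; ring]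
    congr 1
    rw [← hcast, ZMod.stdAddChar_coe]
  rw [Finset.sum_congr rfl fun u _ ↦ hterm u, ← Finset.mul_sum]
  congr 1
  unfold kloostermanSum
  rw [← Finset.sum_filter]
  have hmap : (Finset.univ.filter fun x : ZMod (a.1 + 1) ↦ IsUnit x) =
      Finset.univ.map ⟨(fun u : (ZMod (a.1 + 1))ˣ ↦ (u : ZMod (a.1 + 1))), Units.val_injective⟩ := by
    ext x
    simp only [Finset.mem_filter, Finset.mem_univ, true_and, Finset.mem_map, Function.Embedding.coeFn_mk]
    constructor
    · rintro ⟨u, rfl⟩; exact ⟨u, rfl⟩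
    · rintro ⟨u, rfl⟩; exact u.isUnit
  rw [hmap, Finset.sum_map]
  simp only [Function.Embedding.coeFn_mk]

/-- **Weil's bound for the class sum**: `‖(a²)⁻¹ a^{−2s} S(−n, m w; a)‖ ≤ cellMajorant 1 m a`
(`gcd(m w, a) = gcd(m, a) ≤ m` since `w` is a unit mod `a`). [cite: Iwaniec2002, §2.5 (2.25)] -/
theorem norm_sum_cosetPhase_le [NeZero N] {m : ℕ} (hm : 1 ≤ m) {s : ℝ} (hs : 0 ≤ s) (n : ℤ)
    (a : {r : ℕ // Nat.Coprime (r + 1) N}) :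
    ‖∑ u : (ZMod (a.1 + 1))ˣ, cosetPhase N m s n (cosetClassRow N a u 0)‖ ≤ cellMajorant 1 m (a.1 + 1) := by
  rw [sum_cosetPhase_eq]
  have hA1 : (1 : ℝ) ≤ ((a.1 + 1 : ℕ) : ℝ) := by exact_mod_cast Nat.succ_le_succ (Nat.zero_le _)
  -- `w` is a unit, so `gcd(m·w.val, a) = gcd(m, a) ≤ m`
  have hNunit : IsUnit (-((N : ℤ) : ZMod (a.1 + 1))) := by
    rw [Int.cast_natCast]
    exact ((ZMod.unitOfCoprime N a.2.symm).isUnit).neg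
  have hwunit : IsUnit ((-((N : ℤ) : ZMod (a.1 + 1)))⁻¹) := by
    have h1 : (-((N : ℤ) : ZMod (a.1 + 1))) * (-((N : ℤ) : ZMod (a.1 + 1)))⁻¹ = 1 :=
      ZMod.mul_inv_of_unit _ hNunit
    exact IsUnit.of_mul_eq_one _ (by rw [mul_comm]; exact h1)
  have hwcop : Nat.Coprime ((-((N : ℤ) : ZMod (a.1 + 1)))⁻¹).val (a.1 + 1) := by
    have := ZMod.val_coe_unit_coprime hwunit.unit
    rwa [IsUnit.unit_spec] at this
  have hgcd : (Nat.gcd (Nat.gcd (-n : ℤ).natAbs (cosetKloostB N m (a.1 + 1)).natAbs) (a.1 + 1) : ℝ) ≤ m := by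
    have e : (cosetKloostB N m (a.1 + 1)).natAbs = m * ((-((N : ℤ) : ZMod (a.1 + 1)))⁻¹).val := by
      rw [cosetKloostB, Int.natAbs_mul, Int.natAbs_natCast, Int.natAbs_natCast]
    have h1 : Nat.gcd (Nat.gcd (-n : ℤ).natAbs (cosetKloostB N m (a.1 + 1)).natAbs) (a.1 + 1) ∣
        Nat.gcd (m * ((-((N : ℤ) : ZMod (a.1 + 1)))⁻¹).val) (a.1 + 1) := by
      rw [e]
      exact Nat.dvd_gcd (Nat.dvd_trans (Nat.gcd_dvd_left _ _) (Nat.gcd_dvd_right _ _)) (Nat.gcd_dvd_right _ _)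
    rw [hwcop.gcd_mul_right_cancel m] at h1
    exact_mod_cast Nat.le_of_dvd (by omega) (Nat.dvd_trans h1 (Nat.gcd_dvd_left _ _))
  have hW := weil_kloosterman_bound_holds (a.1 + 1) (-n : ℤ) (cosetKloostB N m (a.1 + 1))
  have hS : ‖kloostermanSum (a.1 + 1) ((-n : ℤ) : ZMod (a.1 + 1))
      ((cosetKloostB N m (a.1 + 1) : ℤ) : ZMod (a.1 + 1))‖ ≤
      Real.sqrt m * Real.sqrt ((a.1 + 1 : ℕ) : ℝ) * (((a.1 + 1).divisors.card : ℕ) : ℝ) := by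
    refine hW.trans ?_
    gcongr
  have h1 : ‖((((a.1 + 1 : ℕ) : ℂ)) ^ 2)⁻¹‖ = ((((a.1 + 1 : ℕ) : ℝ)) ^ 2)⁻¹ := by
    rw [norm_inv, norm_pow, Complex.norm_natCast]
  have h2 : ‖(((((a.1 + 1 : ℕ) : ℝ)) ^ (-(2 * s)) : ℝ) : ℂ)‖ ≤ 1 := by
    rw [Complex.norm_real, Real.norm_of_nonneg (Real.rpow_nonneg (by positivity) _)]
    exact Real.rpow_le_one_of_one_le_of_nonpos hA1 (by linarith)
  rw [norm_mul, norm_mul, h1]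
  calc ((((a.1 + 1 : ℕ) : ℝ)) ^ 2)⁻¹ * ‖(((((a.1 + 1 : ℕ) : ℝ)) ^ (-(2 * s)) : ℝ) : ℂ)‖ *
        ‖kloostermanSum (a.1 + 1) ((-n : ℤ) : ZMod (a.1 + 1)) ((cosetKloostB N m (a.1 + 1) : ℤ) : ZMod (a.1 + 1))‖
      ≤ ((((a.1 + 1 : ℕ) : ℝ)) ^ 2)⁻¹ * 1 *
          (Real.sqrt m * Real.sqrt ((a.1 + 1 : ℕ) : ℝ) * (((a.1 + 1).divisors.card : ℕ) : ℝ)) := by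
        gcongr
    _ = cellMajorant 1 m (a.1 + 1) := by rw [cellMajorant, one_mul]; ring

/-! ## The Fourier coefficients of the coset series and their size -/

/-- The majorant `a ↦ cellMajorant 1 m (a+1)` over the moduli coprime to `N` is summable.
[cite: Iwaniec2002, §2.5 (2.25)] -/
private theorem summable_cosetClassMajorant (N m : ℕ) :
    Summable fun a : {r : ℕ // Nat.Coprime (r + 1) N} ↦ cellMajorant 1 m (a.1 + 1) := by
  have h := ((summable_cellMajorant 1 m).comp_injective (add_left_injective 1)).comp_injective
    (Subtype.val_injective (p := fun r : ℕ ↦ Nat.Coprime (r + 1) N))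
  exact h

/-- **The Fourier coefficients of the coset series** (`N ≥ 2`, `s > 0`):
`∫₀ᴺ cosetP(x+iy,s) e(−nx/N) dx = Σ_{a} (Σ_u cosetPhase) · I_s(m/a², n/N; y)`, summed over
`a = r+1` coprime to `N`. [cite: Iwaniec2002, §3.4 (3.17)] -/
theorem intervalIntegral_cosetP_mul_cexp [NeZero N] (hN : 2 ≤ N) (m : ℕ) {s : ℝ} (hs : 0 < s) (n : ℤ)
    {y : ℝ} (hy : 0 < y) :
    ∫ x in (0 : ℝ)..N, cosetP N m s (UpperHalfPlane.ofComplex ((x : ℂ) + y * I)) *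
        cexp (-(2 * π * I * n * x / N)) =
      ∑' a : {r : ℕ // Nat.Coprime (r + 1) N},
        (∑ u : (ZMod (a.1 + 1))ˣ, cosetPhase N m s n (cosetClassRow N a u 0)) *
          modeIntegral s ((m : ℝ) / ((a.1 + 1 : ℕ) : ℝ) ^ 2) ((n : ℝ) / N) y := by
  rw [← (hasSum_cosetRowMode (N := N) m hs n hy).tsum_eq, tsum_mul_left,
    tsum_row_eq_coset hN (summable_norm_cosetRowMode m hs n hy) (cosetRowMode_negRow m s n y)]
  rw [show (1 / 2 : ℂ) * (2 * ∑' a : {r : ℕ // Nat.Coprime (r + 1) N}, ∑ u : (ZMod (a.1 + 1))ˣ,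
      ∑' ℓ : ℤ, cosetRowMode N m s n y (cosetClassRow N a u ℓ)) =
      ∑' a : {r : ℕ // Nat.Coprime (r + 1) N}, ∑ u : (ZMod (a.1 + 1))ˣ,
        ∑' ℓ : ℤ, cosetRowMode N m s n y (cosetClassRow N a u ℓ) by ring]
  refine tsum_congr fun a ↦ ?_
  rw [Finset.sum_mul]
  refine Finset.sum_congr rfl fun u _ ↦ ?_
  rw [(hasSum_cosetRowMode_class m hs.le n hy a u).tsum_eq, cosetClassRow_apply_one]
  push_cast
  ring_nf

/-- **The size of the Fourier coefficients of the coset series** (`N ≥ 2`, `s > 0`, `m ≥ 1`):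
`‖∫₀ᴺ cosetP(x+iy,s) e(−nx/N) dx‖ ≤ W · (2π/y)(y/2)^{−2s} e^{−π(|n|/N)y}`,
`W = Σ_a cellMajorant 1 m (a+1)`. [cite: Iwaniec2002, §3.4 (3.17), §2.5 (2.25)] -/
theorem norm_intervalIntegral_cosetP_le [NeZero N] (hN : 2 ≤ N) {m : ℕ} (hm : 1 ≤ m) {s : ℝ}
    (hs : 0 < s) (n : ℤ) {y : ℝ} (hy : 0 < y) :
    ‖∫ x in (0 : ℝ)..N, cosetP N m s (UpperHalfPlane.ofComplex ((x : ℂ) + y * I)) *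
        cexp (-(2 * π * I * n * x / N))‖ ≤
      (∑' a : {r : ℕ // Nat.Coprime (r + 1) N}, cellMajorant 1 m (a.1 + 1)) *
        (2 * π / y * (y / 2) ^ (-(2 * s)) * Real.exp (-(π * |(n : ℝ) / N| * y))) := by
  rw [intervalIntegral_cosetP_mul_cexp hN m hs n hy]
  set K : ℝ := 2 * π / y * (y / 2) ^ (-(2 * s)) * Real.exp (-(π * |(n : ℝ) / N| * y)) with hK
  have hbd : ∀ a : {r : ℕ // Nat.Coprime (r + 1) N},
      ‖(∑ u : (ZMod (a.1 + 1))ˣ, cosetPhase N m s n (cosetClassRow N a u 0)) *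
        modeIntegral s ((m : ℝ) / ((a.1 + 1 : ℕ) : ℝ) ^ 2) ((n : ℝ) / N) y‖ ≤
      cellMajorant 1 m (a.1 + 1) * K := by
    intro a
    rw [norm_mul]
    have hA : 0 ≤ (m : ℝ) / ((a.1 + 1 : ℕ) : ℝ) ^ 2 := by positivity
    exact mul_le_mul (norm_sum_cosetPhase_le hm hs.le n a) (norm_modeIntegral_le hs.le hA hy _)
      (norm_nonneg _) (cellMajorant_nonneg (N := 1) m _)
  have hsum : Summable fun a : {r : ℕ // Nat.Coprime (r + 1) N} ↦
      ‖(∑ u : (ZMod (a.1 + 1))ˣ, cosetPhase N m s n (cosetClassRow N a u 0)) *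
        modeIntegral s ((m : ℝ) / ((a.1 + 1 : ℕ) : ℝ) ^ 2) ((n : ℝ) / N) y‖ :=
    ((summable_cosetClassMajorant N m).mul_right K).of_nonneg_of_le (fun _ ↦ norm_nonneg _) hbd
  refine (norm_tsum_le_tsum_norm hsum).trans ?_
  rw [← tsum_mul_right]
  exact hsum.tsum_le_tsum hbd ((summable_cosetClassMajorant N m).mul_right K)

/-! ## The size of the coset series (pointwise Fourier series of period `N`) -/

/-- `n ↦ K e^{−π|n/N|y}` is summable over `ℤ`. [folklore] -/
private theorem summable_exp_neg_abs_div (K : ℝ) {y : ℝ} (hy : 0 < y) {N : ℕ} (hN : 0 < N) :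
    Summable fun n : ℤ ↦ K * Real.exp (-(π * |(n : ℝ) / N| * y)) := by
  have hN' : (0 : ℝ) < N := by exact_mod_cast hN
  have hq : Real.exp (-(π * y / N)) < 1 := Real.exp_lt_one_iff.mpr (by
    have : 0 < π * y / N := by positivity
    linarith)
  have hq0 : 0 ≤ Real.exp (-(π * y / N)) := (Real.exp_pos _).le
  have hnat : Summable fun k : ℕ ↦ K * Real.exp (-(π * |((k : ℤ) : ℝ) / N| * y)) := by
    refine ((summable_geometric_of_lt_one hq0 hq).mul_left K).congr fun k ↦ ?_
    rw [← Real.exp_nat_mul]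
    congr 1
    push_cast
    rw [abs_of_nonneg (by positivity : (0 : ℝ) ≤ (k : ℝ) / N)]
    field_simp
  refine Summable.of_nat_of_neg hnat ?_
  refine hnat.congr fun k ↦ ?_
  push_cast
  rw [neg_div, abs_neg]

/-- The coset series along the horocycle is continuous on `|x| ≤ N`.
[cite: IwaniecKowalski2004, §14.1 (14.4)–(14.5)] -/
private theorem continuousOn_cosetP_hq (m : ℕ) {s : ℝ} (hs : 0 < s) {y : ℝ} (hy : 0 < y) :
    ContinuousOn (fun x : ℝ ↦ cosetP N m s (hq x hy)) (Icc (-(N : ℝ)) N) := by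
  have hterm : ContinuousOn (fun x : ℝ ↦ ∑' v : Row N, cosetTerm N m s v (hq x hy)) (Icc (-(N : ℝ)) N) := by
    refine continuousOn_tsum (fun v ↦ (continuous_cosetTerm_hq m s v hy).continuousOn)
      (summable_cosetMajorant hs hy) ?_
    intro v x hx
    exact norm_cosetTerm_hq_le m hs v hy (abs_le.mpr hx)
  unfold cosetP
  exact continuousOn_const.mul hterm

/-- **The size of the coset series** (`N ≥ 2`, `m ≥ 1`, `s > 0`): with `y = Im τ`,
`‖cosetP N m s τ‖ ≤ (W/N) · (2π/y)(y/2)^{−2s} · Σ_{n∈ℤ} e^{−π(|n|/N)y}`, `W = Σ_a cellMajorant 1 m (a+1)`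
(pointwise Fourier series of period `N` on the horocycle; uniform in `s`).
[cite: Iwaniec2002, §3.4 (3.17)] -/
theorem norm_cosetP_le [NeZero N] (hN : 2 ≤ N) {m : ℕ} (hm : 1 ≤ m) {s : ℝ} (hs : 0 < s) (τ : ℍ) :
    ‖cosetP N m s τ‖ ≤
      (∑' a : {r : ℕ // Nat.Coprime (r + 1) N}, cellMajorant 1 m (a.1 + 1)) / N *
        (2 * π / τ.im * (τ.im / 2) ^ (-(2 * s))) *
          ∑' n : ℤ, Real.exp (-(π * |(n : ℝ) / N| * τ.im)) := by
  have hy : 0 < τ.im := τ.im_pos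
  have hN0 : 0 < N := by omega
  have hNr : (0 : ℝ) < N := by exact_mod_cast hN0
  haveI : Fact (0 < (N : ℝ)) := ⟨hNr⟩
  set W : ℝ := ∑' a : {r : ℕ // Nat.Coprime (r + 1) N}, cellMajorant 1 m (a.1 + 1) with hW
  -- the horocycle function, period `N`
  set f : ℝ → ℂ := fun x ↦ cosetP N m s (UpperHalfPlane.ofComplex ((x : ℂ) + τ.im * I)) with hf
  have hfq : ∀ x, f x = cosetP N m s (hq x hy) := fun x ↦ by simp only [hf, ofComplex_eq_hq x hy]
  have hper : Function.Periodic f N := fun x ↦ by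
    rw [hfq, hfq, ← vadd_hq, cosetP_vadd]
  have hcont : ContinuousOn f (Icc 0 N) := by
    have h := continuousOn_cosetP_hq (N := N) m hs hy
    refine (h.mono fun x hx ↦ ⟨by linarith [hx.1], hx.2⟩).congr fun x _ ↦ hfq x
  set F : C(AddCircle (N : ℝ), ℂ) :=
    ⟨AddCircle.liftIco (N : ℝ) 0 f,
      AddCircle.liftIco_zero_continuous (by simpa using (hper 0).symm) hcont⟩ with hF
  have hFx : ∀ x : ℝ, F (x : AddCircle (N : ℝ)) = f x := by
    intro x
    set x' : ℝ := x - ⌊x / N⌋ * N with hx'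
    have hx'mem : x' ∈ Ico (0 : ℝ) N := by
      have h1 : x' = Int.fract (x / N) * N := by
        rw [hx', Int.fract]; field_simp
      rw [h1]
      exact ⟨mul_nonneg (Int.fract_nonneg _) hNr.le,
        by nlinarith [Int.fract_lt_one (x / N), Int.fract_nonneg (x / N)]⟩
    have hxx : (x : AddCircle (N : ℝ)) = ((x' : ℝ) : AddCircle (N : ℝ)) := by
      rw [hx', AddCircle.coe_sub]
      have : (((⌊x / N⌋ : ℝ) * N : ℝ) : AddCircle (N : ℝ)) = 0 := by
        rw [AddCircle.coe_eq_zero_iff]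
        exact ⟨⌊x / N⌋, by simp⟩
      rw [this, sub_zero]
    rw [hxx]
    change AddCircle.liftIco (N : ℝ) 0 f _ = _
    rw [AddCircle.liftIco_zero_coe_apply hx'mem, hx']
    exact hper.sub_int_mul_eq ⌊x / N⌋
  have hcoeff : ∀ n : ℤ, fourierCoeff F n = (1 / (N : ℝ)) • ∫ x in (0 : ℝ)..N,
      cosetP N m s (UpperHalfPlane.ofComplex ((x : ℂ) + τ.im * I)) * cexp (-(2 * π * I * n * x / N)) := by
    intro n
    rw [fourierCoeff_eq_intervalIntegral F n 0, zero_add]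
    congr 1
    refine intervalIntegral.integral_congr fun x _ ↦ ?_
    rw [fourier_coe_apply, hFx x, smul_eq_mul, mul_comm]
    congr 1
    congr 1
    push_cast
    ring
  set K : ℝ := W * (2 * π / τ.im * (τ.im / 2) ^ (-(2 * s))) with hK
  have hcoeff_le : ∀ n : ℤ, ‖fourierCoeff F n‖ ≤ K / N * Real.exp (-(π * |(n : ℝ) / N| * τ.im)) := by
    intro n
    rw [hcoeff n, norm_smul, Real.norm_of_nonneg (by positivity : (0 : ℝ) ≤ 1 / (N : ℝ))]
    have h := norm_intervalIntegral_cosetP_le hN hm hs n hy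
    calc 1 / (N : ℝ) * ‖∫ x in (0 : ℝ)..N, cosetP N m s (UpperHalfPlane.ofComplex ((x : ℂ) + τ.im * I)) *
          cexp (-(2 * π * I * n * x / N))‖
        ≤ 1 / (N : ℝ) * (W * (2 * π / τ.im * (τ.im / 2) ^ (-(2 * s)) *
            Real.exp (-(π * |(n : ℝ) / N| * τ.im)))) :=
          mul_le_mul_of_nonneg_left h (by positivity)
      _ = K / N * Real.exp (-(π * |(n : ℝ) / N| * τ.im)) := by rw [hK]; ring
  have hsumm : Summable (fourierCoeff F) :=
    Summable.of_norm_bounded (summable_exp_neg_abs_div (K / N) hy hN0) hcoeff_le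
  have key := has_pointwise_sum_fourier_series_of_summable hsumm (τ.re : AddCircle (N : ℝ))
  have hFz : F (τ.re : AddCircle (N : ℝ)) = cosetP N m s τ := by
    rw [hFx, hfq]
    congr 1
    ext1
    rw [hq_coe]
    exact (Complex.re_add_im _)
  rw [hFz] at key
  rw [← key.tsum_eq]
  have hbd : ∀ n : ℤ, ‖fourierCoeff F n • fourier n (τ.re : AddCircle (N : ℝ))‖ ≤
      K / N * Real.exp (-(π * |(n : ℝ) / N| * τ.im)) := by
    intro n
    rw [norm_smul, fourier_coe_apply, show (2 * π * I * n * (τ.re : ℂ) / (N : ℝ)) =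
      ((2 * π * n * τ.re / N : ℝ) : ℂ) * I by push_cast; ring, Complex.norm_exp_ofReal_mul_I, mul_one]
    exact hcoeff_le n
  have hG := summable_exp_neg_abs_div (K / N) hy hN0
  have hsn : Summable fun n : ℤ ↦ ‖fourierCoeff F n • fourier n (τ.re : AddCircle (N : ℝ))‖ :=
    hG.of_nonneg_of_le (fun _ ↦ norm_nonneg _) hbd
  refine (norm_tsum_le_tsum_norm hsn).trans ((hsn.tsum_le_tsum hbd hG).trans (le_of_eq ?_))
  rw [tsum_mul_left, hK, hW]
  ring

end Literature.NumberTheory.ModularForms.PoincareWeightTwo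

end
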